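import Literature.Probability.LatticeModels.MedialInterfaceProofs
import Literature.Probability.LatticeModels.FermionicObservable
import HarnessLib

/-!
# Locality of the medial exploration path (crux `DualCurrentTemplateR`, stmt-CriticalPhenomena-11201,
# line `birth`: Lemma L of `Cruxes/DualCurrentTemplateR/Lines/birth-structure.md`)

The medial exploration path of an admissible discrete Dobrushin domain reads the (boundary-condition
completed) configuration ONLY at the medial vertices it passes through: if two configurations give
the same completed bit at every vertex of `medialExploration D ω`, they have the same exploration
(`medialExploration_eq_of_forall_mem_iff`).  In particular changing the states of a set `B` of edges
none of which lies on the path does not change the path (`fkInterface_sdiff_union_eq`), so the block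
resummation `∑_{η ⊆ B} Φ ((ω ∖ B) ∪ η)` of any PATH functional `Φ = F ∘ fkInterface D` over such a
block is the trivial multiple `2^|B| · Φ ω` (`sum_powerset_comp_fkInterface_eq`).  This is the
tree-level content of Lemma L of the structure note of line `birth` (used there for Theorem A — no
pathwise-CR witness of `Sig.stub_localSolution` at any range — and for the shell reduction of
pattern-free templates at block radius `ρ ≥ 1`).

Proof: in `IsMedialExploration D ω γ` the only `ω`-dependent clause is the turning rule
`IsMedialTurn (D.bcBondConfig ω) e₀ e₁ e₂` at consecutive triples of `γ`, which reads `e₁ ∈ bc ω` and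
`dualEdge e₁ ∈ dualConfig (bc ω)`, i.e. `e₁ ∉ bc ω` (`dualEdge_mem_dualConfig_iff_holds`; `bc ω` and
`e₁` consist of lattice edges); so the exploration of `ω` is an exploration of `ω'`, and uniqueness
(`existsUnique_medialExploration_holds`) concludes.

References: S. Smirnov, C. R. Acad. Sci. Paris 333 (2001), §2 (the exploration process reveals
only the hexagons/edges it touches); G. Grimmett, *Percolation* (1999), §11.2.
-/

noncomputable section

open Literature.Probability Literature.Probability.LatticeModels

namespace Summit.CriticalPhenomena.CardyFormulaZ2.Theorems

/-- The completed configuration consists of lattice edges. [folklore] -/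
theorem bcBondConfig_subset_zdEdgeSet (D : DiscreteDobrushin) (ω : Percolation.BondConfig (Site 2)) :
    D.bcBondConfig ω ⊆ (zdGraph 2).edgeSet :=
  (D.bcBondConfig_subset ω).trans
    (SimpleGraph.edgeSet_subset_edgeSet.2
      ((discreteDomainGraph_le_meshGraph _ _).trans (meshGraph_le_zdGraph _ _)))

/-- The turning rule at `e₁` only reads the bit of `e₁`: if two configurations of lattice edges
agree on `e₁`, a medial turn for one is a medial turn for the other. [cite: Smirnov2001, §2] -/
theorem isMedialTurn_of_mem_iff {β β' : Percolation.BondConfig (Site 2)}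
    (hβ : β ⊆ (zdGraph 2).edgeSet) (hβ' : β' ⊆ (zdGraph 2).edgeSet) {e₀ e₁ e₂ : MedialVertex}
    (h : e₁ ∈ β ↔ e₁ ∈ β') (ht : IsMedialTurn β e₀ e₁ e₂) : IsMedialTurn β' e₀ e₁ e₂ := by
  obtain ⟨v₁, f₁, v₂, f₂, hc₁, hs₁, ht₁, hc₂, hs₂, ht₂, hturn⟩ := ht
  have he₁ : e₁ ∈ (zdGraph 2).edgeSet := by
    obtain ⟨k, hk⟩ := exists_faceAt_of_isCorner hc₁
    rw [← ht₁, hk, cornerTarget_faceAt]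
    exact cTgt_mem_edgeSet (v₁, k)
  refine ⟨v₁, f₁, v₂, f₂, hc₁, hs₁, ht₁, hc₂, hs₂, ht₂, hturn.imp ?_ ?_⟩
  · rintro ⟨hv, hd⟩
    refine ⟨hv, (dualEdge_mem_dualConfig_iff_holds hβ' he₁).2 fun h' => ?_⟩
    exact (dualEdge_mem_dualConfig_iff_holds hβ he₁).1 hd (h.2 h')
  · rintro ⟨hf, he⟩
    exact ⟨hf, h.1 he⟩

/-- An exploration path of `ω` is an exploration path of every `ω'` whose completed configuration
agrees with that of `ω` at the vertices of the path. [cite: Smirnov2001, §2] -/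
theorem isMedialExploration_of_forall_mem_iff (D : DiscreteDobrushin)
    {ω ω' : Percolation.BondConfig (Site 2)} {γ : List MedialVertex}
    (hγ : IsMedialExploration D ω γ)
    (h : ∀ e ∈ γ, (e ∈ D.bcBondConfig ω ↔ e ∈ D.bcBondConfig ω')) :
    IsMedialExploration D ω' γ where
  ne_nil := hγ.ne_nil
  step := hγ.step
  turn e₀ e₁ e₂ hin :=
    isMedialTurn_of_mem_iff (bcBondConfig_subset_zdEdgeSet D ω)
      (bcBondConfig_subset_zdEdgeSet D ω') (h e₁ (hin.subset (by simp))) (hγ.turn e₀ e₁ e₂ hin)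
  nodup := hγ.nodup
  head_mem := hγ.head_mem
  getLast_mem := hγ.getLast_mem
  head_ne_getLast := hγ.head_ne_getLast
  start := hγ.start

/-- **Locality of the exploration.** For admissible Dobrushin data, if the completed configurations of
`ω` and `ω'` agree at every medial vertex of `medialExploration D ω`, then
`medialExploration D ω' = medialExploration D ω`: the path only reads the edges it passes through.
[cite: Smirnov2001, §2] -/
theorem medialExploration_eq_of_forall_mem_iff (D : DiscreteDobrushin) (hD : D.IsZdAdmissible)
    {ω ω' : Percolation.BondConfig (Site 2)}
    (h : ∀ e ∈ medialExploration D ω, (e ∈ D.bcBondConfig ω ↔ e ∈ D.bcBondConfig ω')) :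
    medialExploration D ω' = medialExploration D ω :=
  (existsUnique_medialExploration_holds D hD ω').unique
    (isMedialExploration_medialExploration_holds D hD ω')
    (isMedialExploration_of_forall_mem_iff D (isMedialExploration_medialExploration_holds D hD ω) h)

/-- **Changing edges off the path does not change the FK interface**: if no vertex of
`fkInterface D ω` lies in `B` and `η ⊆ B`, then `fkInterface D ((ω ∖ B) ∪ η) = fkInterface D ω`.
[cite: Smirnov2001, §2] -/
theorem fkInterface_sdiff_union_eq (D : DiscreteDobrushin) (hD : D.IsZdAdmissible)
    {ω : Percolation.BondConfig (Site 2)} {B η : Set MedialVertex}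
    (hB : ∀ e ∈ fkInterface D ω, e ∉ B) (hη : η ⊆ B) :
    fkInterface D ((ω \ B) ∪ η) = fkInterface D ω := by
  refine medialExploration_eq_of_forall_mem_iff D hD fun e he => ?_
  have heB : e ∉ B := hB e he
  have hiff : e ∈ (ω \ B) ∪ η ↔ e ∈ ω :=
    ⟨fun h' => h'.elim (fun h' => h'.1) fun h' => absurd (hη h') heB, fun h' => Or.inl ⟨h', heB⟩⟩
  rw [DiscreteDobrushin.mem_bcBondConfig_iff, DiscreteDobrushin.mem_bcBondConfig_iff, hiff]

/-- **Block resummation of a path functional over a block the path avoids is trivial**: if no vertex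
of `fkInterface D ω` lies in the finite block `B`, then
`∑_{η ⊆ B} F (fkInterface D ((ω ∖ B) ∪ η)) = 2^|B| · F (fkInterface D ω)`. [cite: Smirnov2001, §2] -/
theorem sum_powerset_comp_fkInterface_eq (D : DiscreteDobrushin) (hD : D.IsZdAdmissible)
    {ω : Percolation.BondConfig (Site 2)} (B : Finset MedialVertex)
    (hB : ∀ e ∈ fkInterface D ω, e ∉ (↑B : Set MedialVertex)) (F : List MedialVertex → ℂ) :
    ∑ η ∈ B.powerset, F (fkInterface D ((ω \ (↑B : Set MedialVertex)) ∪ (↑η : Set MedialVertex))) =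
      (2 : ℂ) ^ B.card * F (fkInterface D ω) := by
  rw [Finset.sum_congr rfl fun η hη =>
      congrArg F (fkInterface_sdiff_union_eq D hD hB (Finset.coe_subset.2 (Finset.mem_powerset.1 hη))),
    Finset.sum_const, Finset.card_powerset, nsmul_eq_mul]
  push_cast
  ring

/-! ### Registered form (sub-goal `stub_explorationLocality` of the crux item, line `birth`) -/

/-- **Lemma L of line `birth`** (registered sub-goal `stub_explorationLocality` of
stmt-CriticalPhenomena-11201, signature verbatim): for admissible data, two configurations whose
completed configurations agree at every vertex of the exploration path of the first have the same
exploration path — the path only reads the edges it passes through. [cite: Smirnov2001, §2] -/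
theorem stub_explorationLocality : ∀ (D : DiscreteDobrushin), D.IsZdAdmissible → ∀ (ω ω' : Percolation.BondConfig (Site 2)), (∀ e ∈ medialExploration D ω, (e ∈ D.bcBondConfig ω ↔ e ∈ D.bcBondConfig ω')) → medialExploration D ω' = medialExploration D ω :=
  fun D hD _ _ h => medialExploration_eq_of_forall_mem_iff D hD h

end Summit.CriticalPhenomena.CardyFormulaZ2.Theorems

end
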